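import Summits.CriticalPhenomena.Ising3D.Control2DArith
import Summits.CriticalPhenomena.Ising3D.Control2DMidScheme
import Mathlib.Tactic.NormNum
import HarnessLib

/-!
# The 2D control: the kernel checker for obligation (M) and its soundness
(cell `pub-ising3x`, seat controls-1; evaluates `Control2DMidScheme.lean` in the arithmetic of
`Control2DArith.lean`)

HONEST FRAMING: lottery ticket; floor = tightest certified 3D Ising CFT bounds; no exact-solution
claim without a proof.

For a 2D point functional with rational nodes `(z_k, z̄_k) ∈ (0,1)²` and weights `w_k` at
`Δ_σ = 1/8`, obligation (M) — `φ[F_-[x^a y^b + x^b y^a]] ≥ 0` for `a, b ≥ 0`, `E₀ ≤ a + b < Δ⋆`,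
`a - b ∈ ℤ` — is `Φ_j(E) ≥ 0` for integers `0 ≤ j < Δ⋆` and real `E ∈ [max(E₀, j), Δ⋆)`
(`Control2DMidScheme.pointFunctional_pairPow_eq_Phi`). The checker of this file decides it CELL BY CELL
with the log-free scheme `cell_nonneg_of_convex`: per `j`, unit cells `[E₀ ∨ j + i, · + 1]`, each
possibly refined into `2^r` dyadic sub-cells (an explicit exception table; depth `0` elsewhere), and
per cell the two integer inequalities `negHi(c+H) ≤ posLo(c+H)`, `posHi(c+2H) + negHi(c) ≤ 2 posLo(c+H)`
between the outward-rounded sums, at precision `P`, of the NON-NEGATIVE terms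
`f_d(E) = |c_d| (x_d^j + y_d^j)(x_d y_d)^{(E-j)/2}` — evaluated EXACTLY in structure: integer powers of
the rational coordinates by `Nat.pow` and one rounding (`NI.ofNatFrac`), the half-integer and dyadic
part of the exponent by the checked square-root chain `(x_d y_d)^{1/2^{k+1}}` (`MDat.ch`), the
coefficient `|w_k| v_k^{1/8}` / `|w_k| u_k^{1/8}` by three checked square roots.

* `MDat`, `mkData` — the kernel data of the `2K` evaluation data; `MDat.Models` — what they enclose
  (`mkData_models`);
* `Fval`, `ptSums`, `cellOK`, `fineOK`, `checkJ`, `checkRange` — the checker (all `ℕ` arithmetic);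
* soundness (`Fval_mem`, `ptSums_spec`, `checkJ_sound`, `pair_nonneg_of_checkAll`) is the companion
  file `Control2DMidSound.lean`; the kernel evaluations (`decide +kernel`, chunked in `j`) are in the
  certificate run files.

Mirror / second implementation: `HOME/code/controls/c2dkernel/c2d_kernel.py` (exact integers, same
rounding) — it found the exception table and predicts every kernel verdict.
-/

namespace Summit.CriticalPhenomena.Ising3D.Control2D

open Set Finset
open Literature.MathematicalPhysics.QuantumFieldTheory.ConformalBootstrap3D

/-! ### Kernel data -/

/-- The kernel datum of one evaluation point: sign, `|c_d|` enclosed, the coordinates as fractions of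
naturals `x = xn/xd`, `y = yn/yd`, and the square-root chain `ch[k] ∋ (xy)^{1/2^{k+1}}`. [folklore] -/
structure MDat where
  /-- sign `σ_d` (`true` = `+`) -/
  pos : Bool
  /-- encloses `|c_d|` -/
  cabs : NI
  /-- numerator of `x` -/
  xn : ℕ
  /-- denominator of `x` -/
  xd : ℕ
  /-- numerator of `y` -/
  yn : ℕ
  /-- denominator of `y` -/
  yd : ℕ
  /-- `ch[k]` encloses `(xy)^{1/2^{k+1}}` -/
  ch : List NI

/-- The square-root chain `[√I, √√I, …]` of length `depth`. [folklore] -/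
def sqrtChain (P : ℕ) : ℕ → NI → List NI
  | 0, _ => []
  | k + 1, I => I.sqrt P :: sqrtChain P k (I.sqrt P)

/-- [folklore] -/
theorem sqrtChain_length (P : ℕ) : ∀ (depth : ℕ) (I : NI), (sqrtChain P depth I).length = depth
  | 0, _ => rfl
  | k + 1, I => by simp [sqrtChain, sqrtChain_length P k]

/-- Element `k` of the chain encloses `x^{1/2^{k+1}}`. [folklore] -/
theorem sqrtChain_mem (P : ℕ) : ∀ (depth : ℕ) {I : NI} {x : ℝ}, 0 ≤ x → I.mem P x →
    ∀ (k : ℕ) (hk : k < (sqrtChain P depth I).length),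
      ((sqrtChain P depth I)[k]).mem P (x ^ ((1 : ℝ) / 2 ^ (k + 1)))
  | 0, I, x, _, _, k, hk => by simp [sqrtChain] at hk
  | d + 1, I, x, hx0, hx, k, hk => by
    have hs : (I.sqrt P).mem P (x ^ ((1 : ℝ) / 2 ^ (0 + 1))) := by
      have := NI.mem_sqrt hx
      rwa [Real.sqrt_eq_rpow, show ((1 : ℝ) / 2) = 1 / 2 ^ (0 + 1) by norm_num] at this
    cases k with
    | zero => simpa [sqrtChain] using hs
    | succ k =>
      have hk' : k < (sqrtChain P d (I.sqrt P)).length := by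
        simp [sqrtChain] at hk; simpa [sqrtChain_length] using hk
      have ih := sqrtChain_mem P d (Real.rpow_nonneg hx0 _) hs k hk'
      have e : (x ^ ((1 : ℝ) / 2 ^ (0 + 1))) ^ ((1 : ℝ) / 2 ^ (k + 1)) = x ^ ((1 : ℝ) / 2 ^ (k + 1 + 1)) := by
        rw [← Real.rpow_mul hx0]; congr 1; rw [pow_succ, pow_succ, pow_succ]; field_simp; ring
      rw [e] at ih
      simpa [sqrtChain] using ih

/-- The kernel datum of a point with sign `pos`, coefficient `|w| · base^{1/8}` and rational
coordinates `x, y`. [folklore] -/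
def mkMDat (P depth : ℕ) (pos : Bool) (wabs base x y : ℚ) : MDat :=
  ⟨pos, (NI.ofRat P wabs).mul P (NI.sqrtIter P 3 (NI.ofRat P base)), x.num.toNat, x.den,
    y.num.toNat, y.den, sqrtChain P depth (NI.ofRat P (x * y))⟩

/-- The kernel data of a certificate: direct data `(σ = [0 ≤ w_k], |w_k| v_k^{1/8}, z_k, z̄_k)`
followed by reflected data `(σ = [w_k ≤ 0], |w_k| u_k^{1/8}, 1-z_k, 1-z̄_k)` — the order of
`Control2DMidScheme.realData`. [folklore] -/
def mkData {n : ℕ} (P depth : ℕ) (w z zb : Fin n → ℚ) : List MDat :=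
  (List.ofFn fun k => mkMDat P depth (decide (0 ≤ w k)) |w k| ((1 - z k) * (1 - zb k)) (z k) (zb k)) ++
  (List.ofFn fun k => mkMDat P depth (decide (w k ≤ 0)) |w k| (z k * zb k) (1 - z k) (1 - zb k))

/-- What a kernel datum asserts about a real datum. [folklore] -/
structure MDat.Models (P : ℕ) (d : MDat) (r : RDat) : Prop where
  /-- same sign -/
  sign : d.pos = r.σ
  /-- the coefficient is enclosed -/
  cabs : d.cabs.mem P r.c
  /-- denominators positive -/
  xd_pos : 0 < d.xd
  /-- denominators positive -/
  yd_pos : 0 < d.yd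
  /-- `x = xn / xd` -/
  x_eq : r.x = (d.xn : ℝ) / d.xd
  /-- `y = yn / yd` -/
  y_eq : r.y = (d.yn : ℝ) / d.yd
  /-- the chain encloses the dyadic roots of `xy` -/
  chain : ∀ (k : ℕ) (hk : k < d.ch.length), (d.ch[k]).mem P ((r.x * r.y) ^ ((1 : ℝ) / 2 ^ (k + 1)))

/-- A non-negative rational is `num.toNat / den` in `ℝ`. [folklore] -/
theorem rat_cast_eq_toNat_div {q : ℚ} (hq : 0 ≤ q) : (q : ℝ) = ((q.num.toNat : ℕ) : ℝ) / (q.den : ℝ) := by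
  have hnum : (q.num.toNat : ℤ) = q.num := Int.toNat_of_nonneg (Rat.num_nonneg.mpr hq)
  have hnumR : ((q.num.toNat : ℕ) : ℝ) = (q.num : ℝ) := by exact_mod_cast hnum
  rw [hnumR, Rat.cast_def]

/-- `mkMDat` models the corresponding real datum. [folklore] -/
theorem mkMDat_models (P depth : ℕ) (pos : Bool) {wabs base x y : ℚ} (hw : 0 ≤ wabs)
    (hb : 0 ≤ base) (hx : 0 ≤ x) (hy : 0 ≤ y) :
    (mkMDat P depth pos wabs base x y).Models P
      ⟨pos, (wabs : ℝ) * (base : ℝ) ^ ((1 : ℝ) / 8), (x : ℝ), (y : ℝ)⟩ where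
  sign := rfl
  cabs := by
    have h := NI.mem_sqrtIter (P := P) (by exact_mod_cast hb : (0 : ℝ) ≤ (base : ℝ))
      (NI.mem_ofRat P hb) 3
    have e : ((1 : ℝ) / 2 ^ 3) = 1 / 8 := by norm_num
    rw [e] at h
    exact NI.mem_mul (NI.mem_ofRat P hw) h
  xd_pos := x.den_pos
  yd_pos := y.den_pos
  x_eq := rat_cast_eq_toNat_div hx
  y_eq := rat_cast_eq_toNat_div hy
  chain := by
    intro k hk
    have hxy : (0 : ℝ) ≤ (x : ℝ) * (y : ℝ) := mul_nonneg (by exact_mod_cast hx) (by exact_mod_cast hy)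
    have h := sqrtChain_mem P depth hxy (by simpa using NI.mem_ofRat P (mul_nonneg hx hy)) k hk
    exact h

/-- `Forall₂` along two `List.ofFn` of the same length. [folklore] -/
theorem forall₂_ofFn {α β : Type} {R : α → β → Prop} {n : ℕ} {f : Fin n → α} {g : Fin n → β}
    (h : ∀ k, R (f k) (g k)) : List.Forall₂ R (List.ofFn f) (List.ofFn g) :=
  List.forall₂_of_length_eq_of_get (by simp) fun i h1 h2 => by
    rw [List.get_ofFn, List.get_ofFn]
    exact h _

/-- `mkData` models `realData`, entry by entry. [folklore] -/
theorem mkData_models {n : ℕ} (P depth : ℕ) (w z zb : Fin n → ℚ) (hz : ∀ k, 0 < z k ∧ z k < 1)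
    (hzb : ∀ k, 0 < zb k ∧ zb k < 1) :
    List.Forall₂ (MDat.Models P) (mkData P depth w z zb) (realData w z zb) := by
  unfold mkData realData
  refine List.rel_append (forall₂_ofFn fun k => ?_) (forall₂_ofFn fun k => ?_)
  · have h := mkMDat_models P depth (decide (0 ≤ w k)) (abs_nonneg (w k))
      (mul_nonneg (by linarith [(hz k).2]) (by linarith [(hzb k).2]) : (0 : ℚ) ≤ (1 - z k) * (1 - zb k))
      (hz k).1.le (hzb k).1.le
    push_cast at h
    exact h
  · have h := mkMDat_models P depth (decide (w k ≤ 0)) (abs_nonneg (w k))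
      (mul_nonneg (hz k).1.le (hzb k).1.le)
      (by linarith [(hz k).2] : (0 : ℚ) ≤ 1 - z k) (by linarith [(hzb k).2] : (0 : ℚ) ≤ 1 - zb k)
    push_cast at h
    exact h

/-! ### The checker -/

/-- `x^j + y^j`, exactly then rounded once. [folklore] -/
def powSum (P : ℕ) (d : MDat) (j : ℕ) : NI :=
  NI.ofNatFrac P (d.xn ^ j * d.yd ^ j + d.yn ^ j * d.xd ^ j) (d.xd ^ j * d.yd ^ j)

/-- `(xy)^q` for a natural `q`, exactly then rounded once. [folklore] -/
def xyPow (P : ℕ) (d : MDat) (q : ℕ) : NI :=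
  NI.ofNatFrac P ((d.xn * d.yn) ^ q) ((d.xd * d.yd) ^ q)

/-- Chain element `k` (`∋ (xy)^{1/2^{k+1}}`), with the trivially sound `[0, 1]` beyond the chain.
[folklore] -/
def chAt (P : ℕ) (d : MDat) (k : ℕ) : NI := d.ch.getD k ⟨0, 2 ^ P⟩

/-- `(xy)^{m/2}` for a natural `m`. [folklore] -/
def xyHalf (P : ℕ) (d : MDat) (m : ℕ) : NI :=
  if m % 2 = 0 then xyPow P d (m / 2) else (xyPow P d (m / 2)).mul P (chAt P d 0)

/-- The term `f_d` at `E = j + m0i + m / 2^r`: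
`|c_d| · (x^j + y^j) · (xy)^{m0i/2} · ((xy)^{1/2^{r+1}})^m`. [folklore] -/
def Fval (P : ℕ) (d : MDat) (j m0i r m : ℕ) : NI :=
  (((d.cabs.mul P (powSum P d j)).mul P (xyHalf P d m0i)).mul P ((chAt P d r).powN P m))

/-- The three sums at one point: `(Σ_{σ=+} lo, Σ_{σ=+} hi, Σ_{σ=-} hi)` of the term enclosures.
[folklore] -/
def ptSums (P : ℕ) (j m0i r m : ℕ) : List MDat → ℕ × ℕ × ℕ
  | [] => (0, 0, 0)
  | d :: ds =>
    let acc := ptSums P j m0i r m ds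
    let F := Fval P d j m0i r m
    if d.pos then (acc.1 + F.lo, acc.2.1 + F.hi, acc.2.2) else (acc.1, acc.2.1, acc.2.2 + F.hi)

/-- The two integer inequalities of one cell from the sums at `c`, `c+H`, `c+2H`. [folklore] -/
def cellOK (s0 s1 s2 : ℕ × ℕ × ℕ) : Bool :=
  decide (s1.2.2 ≤ s1.1) && decide (s2.2.1 + s0.2.2 ≤ 2 * s1.1)

/-- `allBelow p n = (∀ k < n, p k)`. [folklore] -/
def allBelow (p : ℕ → Bool) : ℕ → Bool
  | 0 => true
  | k + 1 => p k && allBelow p k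

/-- [folklore] -/
theorem allBelow_spec {p : ℕ → Bool} : ∀ {n : ℕ}, allBelow p n = true → ∀ k < n, p k = true
  | 0, _, k, hk => absurd hk (Nat.not_lt_zero k)
  | n + 1, h, k, hk => by
    simp only [allBelow, Bool.and_eq_true] at h
    rcases Nat.lt_succ_iff_lt_or_eq.mp hk with hlt | heq
    · exact allBelow_spec h.2 k hlt
    · subst heq; exact h.1

/-- The refinement depth of unit cell `i` of index `j` in the exception table (`0` = not refined).
[folklore] -/
def excDepth (exc : List (ℕ × ℕ × ℕ)) (j i : ℕ) : ℕ :=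
  match exc.find? (fun e => e.1 == j && e.2.1 == i) with
  | some e => e.2.2
  | none => 0

/-- Unit cell `i` (of `j`, offset `m0 = (E₀ ∨ j) - j`) refined to depth `r`: the `2^r` sub-cells from
the `2^r + 2` point sums at `E = (E₀ ∨ j) + i + m/2^r`. [folklore] -/
def fineOK (P : ℕ) (ds : List MDat) (j m0 i r : ℕ) : Bool :=
  let V := (List.range (2 ^ r + 2)).map fun m => ptSums P j (m0 + i) r m ds
  allBelow (fun k => cellOK (V.getD k (0, 0, 0)) (V.getD (k + 1) (0, 0, 0)) (V.getD (k + 2) (0, 0, 0)))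
    (2 ^ r)

/-- All unit cells of index `j`: the integer-point sums are computed once (`U`), unrefined cells read
them, refined ones call `fineOK`. [folklore] -/
def checkJ (P : ℕ) (ds : List MDat) (exc : List (ℕ × ℕ × ℕ)) (E0 Dstar j : ℕ) : Bool :=
  let Ea := max E0 j
  let m0 := Ea - j
  let n := Dstar - Ea
  let U := (List.range (n + 2)).map fun i => ptSums P j (m0 + i) 0 0 ds
  allBelow (fun i =>
    if excDepth exc j i = 0 then
      cellOK (U.getD i (0, 0, 0)) (U.getD (i + 1) (0, 0, 0)) (U.getD (i + 2) (0, 0, 0))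
    else fineOK P ds j m0 i (excDepth exc j i)) n

/-- A range of indices `j ∈ [jlo, jlo + cnt)` (the unit of one kernel evaluation). [folklore] -/
def checkRange (P : ℕ) (ds : List MDat) (exc : List (ℕ × ℕ × ℕ)) (E0 Dstar jlo cnt : ℕ) : Bool :=
  allBelow (fun t => checkJ P ds exc E0 Dstar (jlo + t)) cnt

end Summit.CriticalPhenomena.Ising3D.Control2D
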